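import Literature.NumberTheory.DiophantineGeometry.AbcExceptionalSetBounds
import Literature.NumberTheory.DiophantineGeometry.AbcExceptionalSetClassBound
import HarnessLib

/-!
# Proof of Theorem 1.2 of Bernert–Browning–Lichtman–Teräväinen: `N_λ(X) ≪ X^{(23λ+3)/40+ε}`

This file **discharges** the named fact
`Literature.NumberTheory.DiophantineGeometry.bernertEtAl2024_thm_1_2` of
`Literature.NumberTheory.DiophantineGeometry.AbcExceptionalSetBounds`:

> **Theorem 1.2** (C. Bernert, T. Browning, J. D. Lichtman, J. Teräväinen, *Bounds on the
> exceptional set in the abc conjecture*, arXiv:2410.12234 v2, 2026; = Theorem 1 of C. Bernert,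
> *The exceptional set in the abc conjecture*, arXiv:2506.13364, 2025, there for `λ < 2`).
> Let `λ ∈ (0, 2]`. For any `ε > 0`, `N_λ(X) ≪_ε X^{(23λ+3)/40+ε}`.

Nothing in `AbcExceptionalSetBounds` is restated or changed; `bernertEtAl2024_thm_1_2_holds` is a
proof of the `def` as stated there (constant depending on `λ, ε`, all `X ≥ 2`).

## The proof and where it lives

We follow Bernert's two-page argument [Bernert2025, §§2–4] (reduction to shapes, a geometry-of-
numbers bound, a Fourier fourth-moment bound, and the `P₁⁴P₂³P₃²P₄` endgame), made elementary and
split over the auxiliary files (all in the sub-namespace `AbcExceptional`):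

* `AbcExceptionalSetFiveShapes`: `n = x₁x₂²x₃³x₄⁴r` with `x_i = ∏_{p^i ∥ n} p`, `rad n = x₁x₂x₃x₄ rad r`,
  `(rad r)⁵ ≤ r` (the shapes of [BernertEtAl2024, Lemma 2.2] truncated at `d = 4`; the tail `r`
  is classified by the dyadic size of `rad r`, and `#{r ≤ 2C : rad r ∼ ρ} ≪ C^δ ρ^{1+δ}` by Rankin's
  trick, `AbcHits.card_radFibre_le`);
* `AbcExceptionalSetEnergy`, `AbcExceptionalSetDivisorCounting`, `AbcExceptionalSetMoments`: the
  Fourier bound [Bernert2025, Prop. 3] `T⁶ ≪ τ_max³⁰ (#𝒳#𝒴#𝒵)⁴ / (X_jY_jZ_j)` (`j = 2, 3, 4`) for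
  the number `T` of solutions of `F x + F y = F z`, proved in physical space (two Cauchy–Schwarz
  inequalities, the divisor bound of `Literature.NumberTheory.Sieve.DivisorBound`, and strict
  monotonicity of `t ↦ (t+e)^j − t^j` instead of a root count);
* `AbcExceptionalSetLattice`, `AbcExceptionalSetMoments`: the geometry bound [Bernert2025, Prop. 2]
  `S ≤ P/P₁ + 16P/C` via an elementary count of coprime lattice points in a dyadic box
  (`≤ 1 + 8XY/D`, replacing Heath-Brown's lemma);
* `AbcExceptionalSetEndgame`, `AbcExceptionalSetClassBound`: the endgame [Bernert2025, §4] and the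
  resulting bound `≪ C^{(23λ+3)/40+ε/4}` for each dyadic class of shapes.

Here (§1) the abc triples with `c ∈ [C, 2C)` and `rad(abc) < c^λ` are sorted into
`≤ (log₂(2C)+1)¹⁵ ≪ C^{ε/4}` dyadic classes (the dyadic sizes of `x₁, …, x₄, rad r` for each of
`a, b, c`), each class injecting into the solution set bounded by `classBound` (the hypotheses
`X₁X₂²X₃³X₄⁴ρ⁵ ≤ 2C` and `∏ X₁X₂X₃X₄ρ ≤ (2C)^λ` come from `a, b, c < 2C` and
`rad a · rad b · rad c = rad(abc) < c^λ`), so that `M(C) ≪ C^{(23λ+3)/40+ε/2}`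
(`card_dyadicTriples_le`); and (§2) `N_λ(X) ≤ ∑_{2^k ≤ X} M(2^k) ≪ X^{(23λ+3)/40+ε}`.

## References

* [BernertEtAl2024] C. Bernert, T. Browning, J. D. Lichtman, J. Teräväinen, *Bounds on the
  exceptional set in the abc conjecture*, arXiv:2410.12234, v2 (9 May 2026), Theorem 1.2,
  Lemma 2.2, Props. 3.1, 4.1, §5.
* [Bernert2025] C. Bernert, *The exceptional set in the abc conjecture*, arXiv:2506.13364 (2025),
  Theorem 1, Propositions 2–3, §4.
-/

noncomputable section

open Finset UniqueFactorizationMonoid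

open scoped Classical

namespace Literature.NumberTheory.DiophantineGeometry

namespace AbcExceptional

/-! ### §0 Small lemmas -/

/-- `x ∈ [2^e, 2^{e+1})` for `e = ⌊log₂ x⌋`, `x ≥ 1`. [folklore] -/
theorem mem_Ico_pow_log {x e : ℕ} (hx : 0 < x) (he : Nat.log 2 x = e) :
    x ∈ Ico (2 ^ e) (2 * 2 ^ e) := by
  subst he
  refine mem_Ico.mpr ⟨Nat.pow_log_le_self 2 hx.ne', ?_⟩
  have := Nat.lt_pow_succ_log_self (b := 2) (by norm_num) x
  rwa [pow_succ, mul_comm] at this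

/-- `⌊log₂ n⌋ + 1 ≤ (1 + 1/(η log 2)) n^η` for `n ≥ 1`, `η > 0`. [folklore] -/
theorem natLog_two_succ_le {η : ℝ} (hη : 0 < η) {n : ℕ} (hn : 0 < n) :
    ((Nat.log 2 n : ℕ) : ℝ) + 1 ≤ (1 + 1 / (η * Real.log 2)) * (n : ℝ) ^ η := by
  have hn1 : (1 : ℝ) ≤ n := by exact_mod_cast hn
  have hlog2 : 0 < Real.log 2 := Real.log_pos (by norm_num)
  have h1 : ((2 : ℕ) ^ Nat.log 2 n : ℕ) ≤ n := Nat.pow_log_le_self 2 hn.ne'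
  have h2 : (2 : ℝ) ^ (Nat.log 2 n) ≤ n := by exact_mod_cast h1
  have h3 : (Nat.log 2 n : ℝ) * Real.log 2 ≤ Real.log n := by
    rw [← Real.log_pow]
    exact Real.log_le_log (by positivity) h2
  have h4 : Real.log n ≤ (n : ℝ) ^ η / η := Real.log_le_rpow_div (by positivity) hη
  have h5 : (Nat.log 2 n : ℝ) ≤ (n : ℝ) ^ η / (η * Real.log 2) := by
    rw [le_div_iff₀ (by positivity)]
    calc (Nat.log 2 n : ℝ) * (η * Real.log 2) = ((Nat.log 2 n : ℝ) * Real.log 2) * η := by ring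
      _ ≤ Real.log n * η := mul_le_mul_of_nonneg_right h3 hη.le
      _ ≤ (n : ℝ) ^ η / η * η := mul_le_mul_of_nonneg_right h4 hη.le
      _ = (n : ℝ) ^ η := div_mul_cancel₀ _ hη.ne'
  have h6 : (1 : ℝ) ≤ (n : ℝ) ^ η := Real.one_le_rpow hn1 hη.le
  calc ((Nat.log 2 n : ℕ) : ℝ) + 1 ≤ (n : ℝ) ^ η / (η * Real.log 2) + (n : ℝ) ^ η := add_le_add h5 h6
    _ = (1 + 1 / (η * Real.log 2)) * (n : ℝ) ^ η := by ring

/-- For an abc triple, `rad a · rad b · rad c = rad(abc)`. [folklore] -/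
theorem radical_mul_three {a b c : ℕ} (h : IsABCTriple a b c) :
    radical a * radical b * radical c = rad a b c := by
  obtain ⟨ha, hb, habc, hcop⟩ := h
  have hac : Nat.Coprime a c := by
    rw [← habc, add_comm]
    exact Nat.coprime_add_self_right.mpr hcop
  have hbc : Nat.Coprime b c := by
    rw [← habc]
    exact Nat.coprime_add_self_right.mpr hcop.symm
  have habc' : Nat.Coprime (a * b) c := Nat.Coprime.mul_left hac hbc
  rw [rad_def, radical_mul (Nat.coprime_iff_isRelPrime.mp habc'),
    radical_mul (Nat.coprime_iff_isRelPrime.mp hcop)]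

/-! ### §1 One dyadic range `c ∈ [C, 2C)`: `M(C) ≪ C^{(23λ+3)/40 + ε/2}` -/

/-- **Dyadic count.** For `λ ∈ (0, 2]` and `ε > 0` there is `K` with
`#{abc triples : C ≤ c < 2C, rad(abc) < c^λ} ≤ K C^{(23λ+3)/40+ε/2}` for all `C ≥ 1`
(classification by the dyadic sizes of the five-variable shapes of `a, b, c`, then `classBound`).
[cite: Bernert2025, Thm. 1] -/
theorem card_dyadicTriples_le {l ε : ℝ} (hl : 0 < l) (hl2 : l ≤ 2) (hε : 0 < ε) :
    ∃ K : ℝ, 0 < K ∧ ∀ C : ℕ, 0 < C →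
      (#{t ∈ Icc 1 (2 * C) ×ˢ Icc 1 (2 * C) ×ˢ Icc 1 (2 * C) |
          IsABCTriple t.1 t.2.1 t.2.2 ∧ C ≤ t.2.2 ∧ t.2.2 < 2 * C ∧
          ((rad t.1 t.2.1 t.2.2 : ℕ) : ℝ) < (t.2.2 : ℝ) ^ l} : ℝ) ≤
        K * (C : ℝ) ^ ((23 * l + 3) / 40 + ε / 2) := by
  obtain ⟨K, hK, hclass⟩ := classBound hl2 hε
  -- the shapes, chosen once and for all
  choose! x₁ x₂ x₃ x₄ r hsh using fun n (hn : n ≠ 0) => exists_fiveShape hn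
  set F : ℕ × ℕ × ℕ × ℕ × ℕ → ℕ := fun x => x.1 * x.2.1 ^ 2 * x.2.2.1 ^ 3 * x.2.2.2.1 ^ 4 * x.2.2.2.2
    with hF_def
  have hF : ∀ x, F x = x.1 * x.2.1 ^ 2 * x.2.2.1 ^ 3 * x.2.2.2.1 ^ 4 * x.2.2.2.2 := fun x => rfl
  set sh : ℕ → ℕ × ℕ × ℕ × ℕ × ℕ := fun n => (x₁ n, x₂ n, x₃ n, x₄ n, r n) with hsh_def
  have hFsh : ∀ n, n ≠ 0 → F (sh n) = n := fun n hn => (hsh n hn).2.2.2.2.2.1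
  have hle : ∀ n, n ≠ 0 → x₁ n ≤ n ∧ x₂ n ≤ n ∧ x₃ n ≤ n ∧ x₄ n ≤ n ∧ r n ≤ n := by
    intro n hn
    obtain ⟨d1, d2, d3, d4, d5⟩ := dvd_shape F hF (sh n)
    rw [hFsh n hn] at d1 d2 d3 d4 d5
    have hn0 : 0 < n := Nat.pos_of_ne_zero hn
    exact ⟨Nat.le_of_dvd hn0 d1, Nat.le_of_dvd hn0 d2, Nat.le_of_dvd hn0 d3, Nat.le_of_dvd hn0 d4,
      Nat.le_of_dvd hn0 d5⟩
  -- the constant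
  set η : ℝ := ε / 60 with hη
  have hη0 : 0 < η := by positivity
  set Klog : ℝ := 1 + 1 / (η * Real.log 2) with hKlog
  have hKlog0 : 0 < Klog := by
    have : 0 < Real.log 2 := Real.log_pos (by norm_num)
    positivity
  set θ : ℝ := (23 * l + 3) / 40 with hθ
  refine ⟨K * (Klog ^ 15 * (2 : ℝ) ^ (ε / 4)), by positivity, fun C hC => ?_⟩
  set T := {t ∈ Icc 1 (2 * C) ×ˢ Icc 1 (2 * C) ×ˢ Icc 1 (2 * C) |
      IsABCTriple t.1 t.2.1 t.2.2 ∧ C ≤ t.2.2 ∧ t.2.2 < 2 * C ∧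
      ((rad t.1 t.2.1 t.2.2 : ℕ) : ℝ) < (t.2.2 : ℝ) ^ l} with hT
  have memT : ∀ t ∈ T, ((1 ≤ t.1 ∧ t.1 ≤ 2 * C) ∧ (1 ≤ t.2.1 ∧ t.2.1 ≤ 2 * C) ∧
      (1 ≤ t.2.2 ∧ t.2.2 ≤ 2 * C)) ∧ IsABCTriple t.1 t.2.1 t.2.2 ∧ C ≤ t.2.2 ∧ t.2.2 < 2 * C ∧
      ((rad t.1 t.2.1 t.2.2 : ℕ) : ℝ) < (t.2.2 : ℝ) ^ l := by
    intro t ht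
    simpa only [hT, mem_filter, mem_product, mem_Icc] using ht
  -- the datum of a triple
  set d5 : ℕ → ℕ × ℕ × ℕ × ℕ × ℕ := fun n =>
    (Nat.log 2 (x₁ n), Nat.log 2 (x₂ n), Nat.log 2 (x₃ n), Nat.log 2 (x₄ n),
      Nat.log 2 (radical (r n))) with hd5
  set dat : ℕ × ℕ × ℕ → (ℕ × ℕ × ℕ × ℕ × ℕ) × (ℕ × ℕ × ℕ × ℕ × ℕ) × (ℕ × ℕ × ℕ × ℕ × ℕ) :=
    fun t => (d5 t.1, d5 t.2.1, d5 t.2.2) with hdat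
  set L := Nat.log 2 (2 * C) with hL
  have hCr : (0 : ℝ) < C := by exact_mod_cast hC
  have hexp_pos : (0 : ℝ) ≤ K * (C : ℝ) ^ (θ + ε / 4) := by positivity
  -- (i) the number of data
  have hd5mem : ∀ n, n ≠ 0 → n ≤ 2 * C →
      d5 n ∈ range (L + 1) ×ˢ range (L + 1) ×ˢ range (L + 1) ×ˢ range (L + 1) ×ˢ range (L + 1) := by
    intro n hn hn2
    obtain ⟨e1, e2, e3, e4, e5⟩ := hle n hn
    have e6 : radical (r n) ≤ n :=
      (Nat.radical_le_self_iff.mpr (hsh n hn).2.2.2.2.1.ne').trans e5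
    have hb : ∀ m, m ≤ n → Nat.log 2 m ∈ range (L + 1) := fun m hm =>
      mem_range.mpr (Nat.lt_succ_of_le (Nat.log_mono_right (hm.trans hn2)))
    simp only [hd5, mem_product]
    exact ⟨hb _ e1, hb _ e2, hb _ e3, hb _ e4, hb _ e6⟩
  have himg : (#(T.image dat) : ℝ) ≤ Klog ^ 15 * (2 : ℝ) ^ (ε / 4) * (C : ℝ) ^ (ε / 4) := by
    have h1 : #(T.image dat) ≤ (L + 1) ^ 15 := by
      calc #(T.image dat)
          ≤ #((range (L + 1) ×ˢ range (L + 1) ×ˢ range (L + 1) ×ˢ range (L + 1) ×ˢ range (L + 1)) ×ˢ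
              (range (L + 1) ×ˢ range (L + 1) ×ˢ range (L + 1) ×ˢ range (L + 1) ×ˢ range (L + 1)) ×ˢ
              (range (L + 1) ×ˢ range (L + 1) ×ˢ range (L + 1) ×ˢ range (L + 1) ×ˢ range (L + 1))) := by
            refine card_le_card (fun d hd => ?_)
            obtain ⟨t, ht, rfl⟩ := mem_image.mp hd
            obtain ⟨⟨⟨h1, h1'⟩, ⟨h2, h2'⟩, ⟨h3, h3'⟩⟩, -⟩ := memT t ht
            exact mem_product.mpr ⟨hd5mem _ (by omega) h1',
              mem_product.mpr ⟨hd5mem _ (by omega) h2', hd5mem _ (by omega) h3'⟩⟩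
        _ = (L + 1) ^ 15 := by simp only [card_product, card_range]; ring
    have h2 : ((L + 1 : ℕ) : ℝ) ≤ Klog * ((2 * C : ℕ) : ℝ) ^ η := by
      have := natLog_two_succ_le hη0 (n := 2 * C) (by omega)
      push_cast at this ⊢
      exact this
    have h3 : ((2 * C : ℕ) : ℝ) ^ η = (2 : ℝ) ^ η * (C : ℝ) ^ η := by
      push_cast
      exact Real.mul_rpow (by norm_num) hCr.le
    calc (#(T.image dat) : ℝ) ≤ ((L + 1 : ℕ) : ℝ) ^ 15 := by exact_mod_cast h1
      _ ≤ (Klog * ((2 * C : ℕ) : ℝ) ^ η) ^ 15 := pow_le_pow_left₀ (by positivity) h2 15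
      _ = Klog ^ 15 * ((2 : ℝ) ^ η) ^ 15 * ((C : ℝ) ^ η) ^ 15 := by rw [h3]; ring
      _ = Klog ^ 15 * (2 : ℝ) ^ (ε / 4) * (C : ℝ) ^ (ε / 4) := by
          have he : η * ((15 : ℕ) : ℝ) = ε / 4 := by push_cast; rw [hη]; ring
          rw [← Real.rpow_mul_natCast (by norm_num), ← Real.rpow_mul_natCast hCr.le, he]
  -- (ii) each fibre injects into a class counted by `classBound`
  have hfib : ∀ d ∈ T.image dat, #{t ∈ T | dat t = d} ≤ ⌊K * (C : ℝ) ^ (θ + ε / 4)⌋₊ := by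
    intro d hd
    obtain ⟨t₀, ht₀, rfl⟩ := mem_image.mp hd
    obtain ⟨⟨⟨ha₀, ha₀'⟩, ⟨hb₀, hb₀'⟩, ⟨hc₀, hc₀'⟩⟩, habc₀, -, hc2₀, hrad₀⟩ := memT t₀ ht₀
    -- names for the members of `t₀` and the dyadic parameters
    set a₀ := t₀.1 with ha₀_def
    set b₀ := t₀.2.1 with hb₀_def
    set c₀ := t₀.2.2 with hc₀_def
    have ha₀0 : a₀ ≠ 0 := by omega
    have hb₀0 : b₀ ≠ 0 := by omega
    have hc₀0 : c₀ ≠ 0 := by omega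
    obtain ⟨hxa1, hxa2, hxa3, hxa4, hra, hFa, hrada, hr5a⟩ := hsh a₀ ha₀0
    obtain ⟨hxb1, hxb2, hxb3, hxb4, hrb, hFb, hradb, hr5b⟩ := hsh b₀ hb₀0
    obtain ⟨hxc1, hxc2, hxc3, hxc4, hrc, hFc, hradc, hr5c⟩ := hsh c₀ hc₀0
    set X₁ := 2 ^ Nat.log 2 (x₁ a₀) with hX₁
    set X₂ := 2 ^ Nat.log 2 (x₂ a₀) with hX₂
    set X₃ := 2 ^ Nat.log 2 (x₃ a₀) with hX₃
    set X₄ := 2 ^ Nat.log 2 (x₄ a₀) with hX₄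
    set ρa := 2 ^ Nat.log 2 (radical (r a₀)) with hρa
    set Y₁ := 2 ^ Nat.log 2 (x₁ b₀) with hY₁
    set Y₂ := 2 ^ Nat.log 2 (x₂ b₀) with hY₂
    set Y₃ := 2 ^ Nat.log 2 (x₃ b₀) with hY₃
    set Y₄ := 2 ^ Nat.log 2 (x₄ b₀) with hY₄
    set ρb := 2 ^ Nat.log 2 (radical (r b₀)) with hρb
    set Z₁ := 2 ^ Nat.log 2 (x₁ c₀) with hZ₁
    set Z₂ := 2 ^ Nat.log 2 (x₂ c₀) with hZ₂
    set Z₃ := 2 ^ Nat.log 2 (x₃ c₀) with hZ₃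
    set Z₄ := 2 ^ Nat.log 2 (x₄ c₀) with hZ₄
    set ρc := 2 ^ Nat.log 2 (radical (r c₀)) with hρc
    have p2 : ∀ e : ℕ, 0 < 2 ^ e := fun e => pow_pos (by norm_num) e
    -- sizes: `X_i ≤ x_i(a₀)`, `ρa ≤ rad r(a₀)`
    have lX : ∀ {x : ℕ}, 0 < x → 2 ^ Nat.log 2 x ≤ x := fun hx => Nat.pow_log_le_self 2 hx.ne'
    have hrada0 : 0 < radical (r a₀) := Nat.pos_of_ne_zero radical_ne_zero
    have hradb0 : 0 < radical (r b₀) := Nat.pos_of_ne_zero radical_ne_zero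
    have hradc0 : 0 < radical (r c₀) := Nat.pos_of_ne_zero radical_ne_zero
    -- (H1)
    have H1 : ∀ {n X₁ X₂ X₃ X₄ ρ : ℕ}, X₁ ≤ x₁ n → X₂ ≤ x₂ n → X₃ ≤ x₃ n → X₄ ≤ x₄ n →
        ρ ≤ radical (r n) → radical (r n) ^ 5 ≤ r n →
        x₁ n * x₂ n ^ 2 * x₃ n ^ 3 * x₄ n ^ 4 * r n = n → n ≤ 2 * C →
        X₁ * X₂ ^ 2 * X₃ ^ 3 * X₄ ^ 4 * ρ ^ 5 ≤ 2 * C := by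
      intro n X₁ X₂ X₃ X₄ ρ h1 h2 h3 h4 h5 h6 h7 h8
      calc X₁ * X₂ ^ 2 * X₃ ^ 3 * X₄ ^ 4 * ρ ^ 5
          ≤ x₁ n * x₂ n ^ 2 * x₃ n ^ 3 * x₄ n ^ 4 * radical (r n) ^ 5 := by gcongr
        _ ≤ x₁ n * x₂ n ^ 2 * x₃ n ^ 3 * x₄ n ^ 4 * r n := Nat.mul_le_mul_left _ h6
        _ = n := h7
        _ ≤ 2 * C := h8
    have hH1a := H1 (lX hxa1) (lX hxa2) (lX hxa3) (lX hxa4) (lX hrada0) hr5a hFa ha₀'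
    have hH1b := H1 (lX hxb1) (lX hxb2) (lX hxb3) (lX hxb4) (lX hradb0) hr5b hFb hb₀'
    have hH1c := H1 (lX hxc1) (lX hxc2) (lX hxc3) (lX hxc4) (lX hradc0) hr5c hFc hc₀'
    -- (H2)
    have hH2 : ((X₁ * X₂ * X₃ * X₄ * ρa) * (Y₁ * Y₂ * Y₃ * Y₄ * ρb) * (Z₁ * Z₂ * Z₃ * Z₄ * ρc) : ℝ) ≤
        (2 * C : ℝ) ^ l := by
      have h1 : (X₁ * X₂ * X₃ * X₄ * ρa) * (Y₁ * Y₂ * Y₃ * Y₄ * ρb) * (Z₁ * Z₂ * Z₃ * Z₄ * ρc) ≤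
          rad a₀ b₀ c₀ := by
        rw [← radical_mul_three habc₀, ← hrada, ← hradb, ← hradc]
        gcongr <;> exact lX (by assumption)
      have h2 : (((X₁ * X₂ * X₃ * X₄ * ρa) * (Y₁ * Y₂ * Y₃ * Y₄ * ρb) *
          (Z₁ * Z₂ * Z₃ * Z₄ * ρc) : ℕ) : ℝ) ≤ ((rad a₀ b₀ c₀ : ℕ) : ℝ) := by exact_mod_cast h1
      have h3 : ((rad a₀ b₀ c₀ : ℕ) : ℝ) < (c₀ : ℝ) ^ l := hrad₀
      have h4 : (c₀ : ℝ) ^ l ≤ (2 * C : ℝ) ^ l :=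
        Real.rpow_le_rpow (by positivity) (by exact_mod_cast hc2₀.le) hl.le
      push_cast at h2
      exact h2.trans (h3.le.trans h4)
    -- the class and its bound
    set Sol := {t ∈ (Ico X₁ (2 * X₁) ×ˢ Ico X₂ (2 * X₂) ×ˢ Ico X₃ (2 * X₃) ×ˢ Ico X₄ (2 * X₄) ×ˢ
          {s ∈ Icc 1 (2 * C) | ρa ≤ radical s ∧ radical s < 2 * ρa}) ×ˢ
        ((Ico Y₁ (2 * Y₁) ×ˢ Ico Y₂ (2 * Y₂) ×ˢ Ico Y₃ (2 * Y₃) ×ˢ Ico Y₄ (2 * Y₄) ×ˢ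
          {s ∈ Icc 1 (2 * C) | ρb ≤ radical s ∧ radical s < 2 * ρb}) ×ˢ
        (Ico Z₁ (2 * Z₁) ×ˢ Ico Z₂ (2 * Z₂) ×ˢ Ico Z₃ (2 * Z₃) ×ˢ Ico Z₄ (2 * Z₄) ×ˢ
          {s ∈ Icc 1 (2 * C) | ρc ≤ radical s ∧ radical s < 2 * ρc})) |
        F t.1 + F t.2.1 = F t.2.2 ∧ Nat.Coprime (F t.1) (F t.2.1) ∧ C ≤ F t.2.2} with hSol
    have key : (#Sol : ℝ) ≤ K * (C : ℝ) ^ (θ + ε / 4) :=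
      hclass F hF C X₁ X₂ X₃ X₄ ρa Y₁ Y₂ Y₃ Y₄ ρb Z₁ Z₂ Z₃ Z₄ ρc hC (p2 _) (p2 _) (p2 _) (p2 _)
        (p2 _) (p2 _) (p2 _) (p2 _) (p2 _) (p2 _) (p2 _) (p2 _) (p2 _) (p2 _) (p2 _)
        hH1a hH1b hH1c hH2
    -- membership of shapes in the class
    have shape_mem : ∀ {n m : ℕ}, n ≠ 0 → n ≤ 2 * C → m ≠ 0 → d5 n = d5 m →
        sh n ∈ Ico (2 ^ Nat.log 2 (x₁ m)) (2 * 2 ^ Nat.log 2 (x₁ m)) ×ˢ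
          Ico (2 ^ Nat.log 2 (x₂ m)) (2 * 2 ^ Nat.log 2 (x₂ m)) ×ˢ
          Ico (2 ^ Nat.log 2 (x₃ m)) (2 * 2 ^ Nat.log 2 (x₃ m)) ×ˢ
          Ico (2 ^ Nat.log 2 (x₄ m)) (2 * 2 ^ Nat.log 2 (x₄ m)) ×ˢ
          {s ∈ Icc 1 (2 * C) | 2 ^ Nat.log 2 (radical (r m)) ≤ radical s ∧
            radical s < 2 * 2 ^ Nat.log 2 (radical (r m))} := by
      intro n m hn hn2 hm hd
      obtain ⟨h1, h2, h3, h4, h5, -, -, -⟩ := hsh n hn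
      simp only [hd5, Prod.mk.injEq] at hd
      obtain ⟨e1, e2, e3, e4, e5⟩ := hd
      have h5' : 0 < radical (r n) := Nat.pos_of_ne_zero radical_ne_zero
      have hrn : r n ≤ 2 * C := (hle n hn).2.2.2.2.trans hn2
      simp only [hsh_def, mem_product]
      refine ⟨mem_Ico_pow_log h1 e1, mem_Ico_pow_log h2 e2, mem_Ico_pow_log h3 e3,
        mem_Ico_pow_log h4 e4, ?_⟩
      have := mem_Ico_pow_log h5' e5
      rw [mem_Ico] at this
      exact mem_filter.mpr ⟨mem_Icc.mpr ⟨h5, hrn⟩, this⟩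
    have hinj : #{t ∈ T | dat t = dat t₀} ≤ #Sol := by
      refine card_le_card_of_injOn (fun t => (sh t.1, sh t.2.1, sh t.2.2)) (fun t ht => ?_)
        (fun t ht t' ht' h => ?_)
      · obtain ⟨htT, hd⟩ := mem_filter.mp (Finset.mem_coe.mp ht)
        obtain ⟨⟨⟨ha, ha'⟩, ⟨hb, hb'⟩, ⟨hc, hc'⟩⟩, habc, hCc, -, -⟩ := memT t htT
        simp only [hdat, Prod.mk.injEq] at hd
        obtain ⟨hda, hdb, hdc⟩ := hd
        have ha0 : t.1 ≠ 0 := by omega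
        have hb0 : t.2.1 ≠ 0 := by omega
        have hc0 : t.2.2 ≠ 0 := by omega
        have hmem : (sh t.1, sh t.2.1, sh t.2.2) ∈ Sol := by
          rw [hSol, mem_filter]
          refine ⟨mem_product.mpr ⟨shape_mem ha0 ha' ha₀0 hda, mem_product.mpr
            ⟨shape_mem hb0 hb' hb₀0 hdb, shape_mem hc0 hc' hc₀0 hdc⟩⟩, ?_, ?_, ?_⟩
          · show F (sh t.1) + F (sh t.2.1) = F (sh t.2.2)
            rw [hFsh _ ha0, hFsh _ hb0, hFsh _ hc0]
            exact habc.2.2.1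
          · show Nat.Coprime (F (sh t.1)) (F (sh t.2.1))
            rw [hFsh _ ha0, hFsh _ hb0]
            exact habc.2.2.2
          · show C ≤ F (sh t.2.2)
            rw [hFsh _ hc0]
            exact hCc
        exact Finset.mem_coe.mpr hmem
      · obtain ⟨htT, -⟩ := mem_filter.mp (Finset.mem_coe.mp ht)
        obtain ⟨htT', -⟩ := mem_filter.mp (Finset.mem_coe.mp ht')
        obtain ⟨⟨⟨ha, -⟩, ⟨hb, -⟩, ⟨hc, -⟩⟩, -⟩ := memT t htT
        obtain ⟨⟨⟨ha', -⟩, ⟨hb', -⟩, ⟨hc', -⟩⟩, -⟩ := memT t' htT'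
        simp only [Prod.mk.injEq] at h
        obtain ⟨h1, h2, h3⟩ := h
        have e1 : t.1 = t'.1 := by
          rw [← hFsh t.1 (by omega), ← hFsh t'.1 (by omega), h1]
        have e2 : t.2.1 = t'.2.1 := by
          rw [← hFsh t.2.1 (by omega), ← hFsh t'.2.1 (by omega), h2]
        have e3 : t.2.2 = t'.2.2 := by
          rw [← hFsh t.2.2 (by omega), ← hFsh t'.2.2 (by omega), h3]
        exact Prod.ext e1 (Prod.ext e2 e3)
    refine Nat.le_floor ?_
    calc (#{t ∈ T | dat t = dat t₀} : ℝ) ≤ #Sol := by exact_mod_cast hinj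
      _ ≤ K * (C : ℝ) ^ (θ + ε / 4) := key
  -- (iii) assemble
  have hmain := card_le_mul_card_image T _ hfib
  calc (#T : ℝ) ≤ (⌊K * (C : ℝ) ^ (θ + ε / 4)⌋₊ : ℝ) * #(T.image dat) := by
        exact_mod_cast hmain
    _ ≤ (K * (C : ℝ) ^ (θ + ε / 4)) * (Klog ^ 15 * (2 : ℝ) ^ (ε / 4) * (C : ℝ) ^ (ε / 4)) :=
        mul_le_mul (Nat.floor_le hexp_pos) himg (Nat.cast_nonneg _) hexp_pos
    _ = K * (Klog ^ 15 * (2 : ℝ) ^ (ε / 4)) * ((C : ℝ) ^ (θ + ε / 4) * (C : ℝ) ^ (ε / 4)) := by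
        ring
    _ = K * (Klog ^ 15 * (2 : ℝ) ^ (ε / 4)) * (C : ℝ) ^ ((23 * l + 3) / 40 + ε / 2) := by
        rw [← Real.rpow_add hCr, hθ]
        ring_nf

/-! ### §2 Summing over the dyadic ranges of `c` -/

/-- The set counted by `N_λ(X)` as a finset. [folklore] -/
theorem abcExponentCount_eq_card (l : ℝ) (X : ℕ) :
    abcExponentCount l X = #{t ∈ Icc 1 X ×ˢ Icc 1 X ×ˢ Icc 1 X |
      IsABCTriple t.1 t.2.1 t.2.2 ∧ t.2.2 ≤ X ∧
        ((rad t.1 t.2.1 t.2.2 : ℕ) : ℝ) < (t.2.2 : ℝ) ^ l} := by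
  rw [abcExponentCount_def, ← Set.ncard_coe_finset]
  congr 1
  ext ⟨a, b, c⟩
  simp only [Set.mem_setOf_eq, coe_filter, mem_product, mem_Icc]
  constructor
  · rintro ⟨ht, hcX, hlt⟩
    obtain ⟨ha, hb, habc, -⟩ := id ht
    exact ⟨⟨⟨ha, by omega⟩, ⟨hb, by omega⟩, ⟨by omega, hcX⟩⟩, ht, hcX, hlt⟩
  · rintro ⟨-, ht, hcX, hlt⟩
    exact ⟨ht, hcX, hlt⟩

end AbcExceptional

open AbcExceptional in
/-- **Bernert–Browning–Lichtman–Teräväinen, Theorem 1.2** (arXiv:2410.12234 v2; = Bernert,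
arXiv:2506.13364, Theorem 1): for `λ ∈ (0, 2]` and `ε > 0` there is `C` with
`N_λ(X) ≤ C · X^{(23λ+3)/40+ε}` for all `X ≥ 2`. Discharge of the named fact
`bernertEtAl2024_thm_1_2`; the proof is Bernert's (shapes, geometry of numbers, fourth moment,
endgame), assembled from the `AbcExceptional*` files — see the module docstring.
[cite: BernertEtAl2024, Thm. 1.2 (arXiv v2)] -/
theorem bernertEtAl2024_thm_1_2_holds : bernertEtAl2024_thm_1_2 := by
  intro l hl hl2 ε hε
  obtain ⟨K, hK, hM⟩ := card_dyadicTriples_le hl hl2 hε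
  set θ : ℝ := (23 * l + 3) / 40 with hθ
  set η : ℝ := ε / 2 with hη
  have hη0 : 0 < η := by positivity
  set Klog : ℝ := 1 + 1 / (η * Real.log 2) with hKlog
  have hKlog0 : 0 < Klog := by
    have : 0 < Real.log 2 := Real.log_pos (by norm_num)
    positivity
  refine ⟨K * Klog, fun X hX => ?_⟩
  have hθ0 : 0 ≤ θ + ε / 2 := by rw [hθ]; positivity
  have hX0 : 0 < X := by omega
  have hXr : (1 : ℝ) ≤ X := by exact_mod_cast hX0
  have hXr0 : (0 : ℝ) < X := by positivity
  rw [abcExponentCount_eq_card]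
  set T := {t ∈ Icc 1 X ×ˢ Icc 1 X ×ˢ Icc 1 X |
      IsABCTriple t.1 t.2.1 t.2.2 ∧ t.2.2 ≤ X ∧
        ((rad t.1 t.2.1 t.2.2 : ℕ) : ℝ) < (t.2.2 : ℝ) ^ l} with hT
  set L := Nat.log 2 X with hL
  have hmaps : Set.MapsTo (fun t : ℕ × ℕ × ℕ => Nat.log 2 t.2.2) (T : Set (ℕ × ℕ × ℕ))
      (range (L + 1) : Finset ℕ) := by
    intro t ht
    have h := (mem_filter.mp (Finset.mem_coe.mp ht)).2.2.1
    exact Finset.mem_coe.mpr (mem_range.mpr (Nat.lt_succ_of_le (Nat.log_mono_right h)))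
  have hfib : ∀ k ∈ range (L + 1),
      (#{t ∈ T | Nat.log 2 t.2.2 = k} : ℝ) ≤ K * (X : ℝ) ^ (θ + ε / 2) := by
    intro k hk
    have h2k : 0 < 2 ^ k := pow_pos (by norm_num) k
    have hsub : #{t ∈ T | Nat.log 2 t.2.2 = k} ≤
        #{t ∈ Icc 1 (2 * 2 ^ k) ×ˢ Icc 1 (2 * 2 ^ k) ×ˢ Icc 1 (2 * 2 ^ k) |
          IsABCTriple t.1 t.2.1 t.2.2 ∧ 2 ^ k ≤ t.2.2 ∧ t.2.2 < 2 * 2 ^ k ∧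
          ((rad t.1 t.2.1 t.2.2 : ℕ) : ℝ) < (t.2.2 : ℝ) ^ l} := by
      refine card_le_card (fun t ht => ?_)
      obtain ⟨htT, hk'⟩ := mem_filter.mp ht
      obtain ⟨-, habc, -, hlt⟩ := mem_filter.mp htT
      obtain ⟨ha, hb, hsum, -⟩ := id habc
      have hc := mem_Ico.mp (mem_Ico_pow_log (x := t.2.2) (by omega) hk')
      simp only [mem_filter, mem_product, mem_Icc]
      exact ⟨⟨⟨ha, by omega⟩, ⟨hb, by omega⟩, ⟨by omega, by omega⟩⟩, habc, hc.1, hc.2, hlt⟩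
    have h2kX : ((2 ^ k : ℕ) : ℝ) ≤ X := by
      have : 2 ^ k ≤ X := by
        have hk' := mem_range.mp hk
        calc 2 ^ k ≤ 2 ^ L := Nat.pow_le_pow_right (by norm_num) (by omega)
          _ ≤ X := Nat.pow_log_le_self 2 hX0.ne'
      exact_mod_cast this
    calc (#{t ∈ T | Nat.log 2 t.2.2 = k} : ℝ) ≤ K * ((2 ^ k : ℕ) : ℝ) ^ (θ + ε / 2) :=
          le_trans (by exact_mod_cast hsub) (hM (2 ^ k) h2k)
      _ ≤ K * (X : ℝ) ^ (θ + ε / 2) := by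
          gcongr
  have hL1 : ((L + 1 : ℕ) : ℝ) ≤ Klog * (X : ℝ) ^ η := by
    have := natLog_two_succ_le hη0 hX0
    push_cast at this ⊢
    exact this
  rw [card_eq_sum_card_fiberwise hmaps]
  push_cast
  calc ∑ k ∈ range (L + 1), (#{t ∈ T | Nat.log 2 t.2.2 = k} : ℝ)
      ≤ ∑ k ∈ range (L + 1), K * (X : ℝ) ^ (θ + ε / 2) := sum_le_sum hfib
    _ = ((L + 1 : ℕ) : ℝ) * (K * (X : ℝ) ^ (θ + ε / 2)) := by
        rw [sum_const, card_range, nsmul_eq_mul]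
    _ ≤ (Klog * (X : ℝ) ^ η) * (K * (X : ℝ) ^ (θ + ε / 2)) :=
        mul_le_mul_of_nonneg_right hL1 (by positivity)
    _ = K * Klog * ((X : ℝ) ^ (θ + ε / 2) * (X : ℝ) ^ η) := by ring
    _ = K * Klog * (X : ℝ) ^ ((23 * l + 3) / 40 + ε) := by
        rw [← Real.rpow_add hXr0, hθ, hη]
        ring_nf

end Literature.NumberTheory.DiophantineGeometry
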